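import Literature.Analysis.FluidPDE.CylindricalTrajectory
import Literature.Analysis.FluidPDE.TimeAverageSupport
import HarnessLib

/-!
# Time-average measures satisfy the stationary Liouville equation

Analysis/FluidPDE support file for the discharge of
`Literature.Analysis.FluidPDE.timeAverage_isStationary` (Foias–Manley–Rosa–Temam 2001, Ch. IV
Thm. 3.1): property **(1.30)** of a stationary statistical solution,
`∫ ⟨F(u), Φ'(u)⟩ dμ(u) = 0` for every cylindrical test functional `Φ`, for a time-average
measure `μ` of a global Leray–Hopf solution on `T^d` with steady force `F ∈ L²`
(FMRT 2001, App. B.2, (B.17)–(B.23), PDF pp. 255–258). The printed chain of equalities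

  `∫ ⟨F(u), Φ'(u)⟩ dμ = Lim T⁻¹ ∫₀ᵀ ⟨F(u(t)), Φ'(u(t))⟩ dt = Lim T⁻¹ (Φ(u(T)) - Φ(u(0))) = 0`

is made honest as follows (no Galerkin truncation is needed for the cylindrical class):

* `IsGlobalLerayHopf.integrableOn_generator` — `t ↦ ⟨F(U t), Φ'(U t)⟩` is integrable on every
  `(0, T]` (bounded continuous coefficients `∂ᵢφ(coords)` times the integrable fluxes);
* `IsGlobalLerayHopf.tendsto_timeMean_generator` — its Cesàro means tend to `0`: by the chain
  rule `∫₁ᵀ = Φ(U T) - Φ(U 1)` (`IsGlobalLerayHopf.cylindrical_eval_sub_eq_integral`,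
  `CylindricalTrajectory`) and `Φ` is bounded (FMRT (B.19)–(B.20));
* `IsTimeAverageMeasure.integrable_generator`, `IsTimeAverageMeasure.integral_generator_eq_zero` —
  **(1.30)**: the observable `u ↦ ⟨F(u), Φ'(u)⟩` is norm-continuous but unbounded on `H`; since
  the trajectory stays in a ball `B` (`IsGlobalLerayHopf.exists_forall_integral_norm_sq_le`,
  FMRT (3.2)) and `μ(H ∖ B) = 0`, it may be multiplied by a continuous cutoff in `|u|²` without
  changing either side (`IsTimeAverageMeasure.integral_eq_of_eqOn`, the norm-topology form of
  FMRT Cor. 3.1), and the generalized limit of means tending to `0` is `0`.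

## Mathlib / tree search

Used from the tree: `CylindricalTrajectory`, `CylindricalGenerator`, `LerayHopfUniformEnergy`,
`TimeAverageMeasureBasic`, `TimeAverageSupport` (carrying ball, energy cutoff); from Mathlib `Integrable.bdd_mul`, `ContinuousOn.aestronglyMeasurable`,
`intervalIntegral.integral_add_adjacent_intervals`. Nothing on Liouville / Hopf equations for
measures exists in Mathlib.

## References

* C. Foias, O. Manley, R. Rosa, R. Temam, *Navier–Stokes Equations and Turbulence*, Cambridge
  Univ. Press (2001), Ch. IV §1.2 Def. 1.3 (1.30) (PDF p. 197); §3.1 Thm. 3.1, Cor. 3.1, (3.2)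
  (PDF pp. 208–210); App. B.2 (B.17)–(B.23) (PDF pp. 255–258). [FMRT2001]
-/

noncomputable section

open MeasureTheory Set Filter Topology UnitAddTorus
open scoped InnerProductSpace RealInnerProductSpace ENNReal NNReal

namespace Literature.Analysis.FluidPDE.Torus

variable {d : Type*} [Fintype d] [DecidableEq d]

/-- Local notation for the real Hilbert space `L²(T^d; ℝ^d)`. -/
local notation "L2T " d':max => Lp (EuclideanSpace ℝ d') 2 (volume : Measure (UnitAddTorus d'))

/-- Local notation for real vector fields `T^d → ℝ^d`. -/
local notation "Vec " d':max => UnitAddTorus d' → EuclideanSpace ℝ d'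

variable {ν : ℝ} {F u₀ : Vec d} {u : ℝ → Vec d} {U : ℝ → FunctionSpaces.Torus.energySpace d}

/-! ### The tested generator along the trajectory: integrability and vanishing time means -/

section Trajectory

/-- The coordinates `t ↦ coords (U t) = ((U t, g₁),…,(U t, gₘ))` of the lifted trajectory are
continuous on `(0, T]` (weak `L²`-continuity of Leray–Hopf solutions). [folklore] -/
theorem IsGlobalLerayHopf.continuousOn_coords_lift (hu : IsGlobalLerayHopf ν (fun _ => F) u₀ u)
    (hU : ∀ t, 0 ≤ t → ((U t : L2T d) : Vec d) =ᵐ[volume] u t) (Φ : CylindricalTest d) {T : ℝ}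
    (hT : 0 < T) : ContinuousOn (fun t => Φ.coords (U t)) (Ioc 0 T) := by
  have hc : ContinuousOn (fun t => (WithLp.toLp 2 fun i => ∫ x, ⟪u t x, Φ.g i x⟫ :
      EuclideanSpace ℝ (Fin Φ.m))) (Ioc 0 T) :=
    (PiLp.continuous_toLp 2 _).comp_continuousOn (continuousOn_pi.2 fun i =>
      ((hu T hT).weak_continuous (Φ.g i) ((Φ.g_smooth i).memLp 2)).1)
  refine hc.congr fun t ht => ?_
  show (WithLp.toLp 2 fun i => pairing (U t : L2T d) (Φ.g i)) = _
  congr 1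
  funext i
  exact pairing_lift_eq hU (Φ.g i) ht.1.le

/-- **The tested generator along the trajectory is integrable on every `(0, T]`**:
`t ↦ ⟨F(U t), Φ'(U t)⟩ = ∑ᵢ ∂ᵢφ(coords (U t)) fluxᵢ(t)` with bounded continuous coefficients and
integrable fluxes. [folklore] -/
theorem IsGlobalLerayHopf.integrableOn_generator (hF : MemLp F 2 volume)
    (hu : IsGlobalLerayHopf ν (fun _ => F) u₀ u)
    (hU : ∀ t, 0 ≤ t → ((U t : L2T d) : Vec d) =ᵐ[volume] u t) (Φ : CylindricalTest d) {T : ℝ}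
    (hT : 0 < T) :
    IntegrableOn (fun t => nsGeneratorPairing ν F (U t) (Φ.grad (U t))) (Ioc 0 T) := by
  obtain ⟨M, -, hM⟩ := Φ.exists_abs_fderiv_coords_le
  have hsum : IntegrableOn (fun t => ∑ i, _root_.fderiv ℝ Φ.φ (Φ.coords (U t)) (EuclideanSpace.single i 1) *
      trajFlux ν F u (Φ.g i) t) (Ioc 0 T) := by
    refine integrable_finsetSum _ fun i _ => ?_
    have hfl : IntegrableOn (trajFlux ν F u (Φ.g i)) (Ioc 0 T) :=
      (integrableOn_Ioc_iff_integrableOn_Ioo).mpr (hu.integrableOn_trajFlux hF (Φ.g_smooth i) hT)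
    have hc : AEStronglyMeasurable (fun t => _root_.fderiv ℝ Φ.φ (Φ.coords (U t))
        (EuclideanSpace.single i 1)) (volume.restrict (Ioc 0 T)) := by
      have hcont : Continuous fun v : EuclideanSpace ℝ (Fin Φ.m) =>
          _root_.fderiv ℝ Φ.φ v (EuclideanSpace.single i 1) :=
        (ContinuousLinearMap.apply ℝ ℝ (EuclideanSpace.single i (1 : ℝ))).continuous.comp
          (Φ.φ_contDiff.continuous_fderiv one_ne_zero)
      exact (hcont.comp_continuousOn (hu.continuousOn_coords_lift hU Φ hT)).aestronglyMeasurable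
        measurableSet_Ioc
    exact hfl.bdd_mul hc (ae_of_all _ fun t => by rw [Real.norm_eq_abs]; exact hM _ i)
  refine hsum.congr_fun (fun t ht => ?_) measurableSet_Ioc
  exact (nsGeneratorPairing_grad_lift_eq_sum hF hU Φ ht.1.le).symm

/-- The tested generator along the trajectory is interval integrable on `[a, b]`, `0 ≤ a ≤ b`. [folklore] -/
theorem IsGlobalLerayHopf.intervalIntegrable_generator (hF : MemLp F 2 volume)
    (hu : IsGlobalLerayHopf ν (fun _ => F) u₀ u)
    (hU : ∀ t, 0 ≤ t → ((U t : L2T d) : Vec d) =ᵐ[volume] u t) (Φ : CylindricalTest d) {a b : ℝ}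
    (ha : 0 ≤ a) (hab : a ≤ b) :
    IntervalIntegrable (fun t => nsGeneratorPairing ν F (U t) (Φ.grad (U t))) volume a b := by
  rw [intervalIntegrable_iff_integrableOn_Ioc_of_le hab]
  exact (hu.integrableOn_generator hF hU Φ (by linarith : 0 < b + 1)).mono_set
    (Ioc_subset_Ioc ha (by linarith))

/-- **The Cesàro means of the tested generator vanish in the limit** (FMRT 2001, App. B.2,
(B.19)–(B.20)): `T⁻¹ ∫₀ᵀ ⟨F(U t), Φ'(U t)⟩ dt = T⁻¹ (∫₀¹ ⋯ + Φ(U T) - Φ(U 1)) → 0`, since `Φ`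
is bounded. [cite: FMRT2001, App. B.2 (B.19)–(B.20)] -/
theorem IsGlobalLerayHopf.tendsto_timeMean_generator (hF : MemLp F 2 volume)
    (hu : IsGlobalLerayHopf ν (fun _ => F) u₀ u)
    (hU : ∀ t, 0 ≤ t → ((U t : L2T d) : Vec d) =ᵐ[volume] u t) (Φ : CylindricalTest d) :
    Tendsto (timeMean fun t => nsGeneratorPairing ν F (U t) (Φ.grad (U t))) atTop (𝓝 0) := by
  obtain ⟨M, hM⟩ := Φ.exists_abs_eval_le
  set G : ℝ → ℝ := fun t => nsGeneratorPairing ν F (U t) (Φ.grad (U t)) with hG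
  set C₁ : ℝ := ∫ t in (0 : ℝ)..1, G t with hC₁
  have hsplit : ∀ T, 1 ≤ T → ∫ t in (0 : ℝ)..T, G t = C₁ + (Φ.eval (U T) - Φ.eval (U 1)) := by
    intro T hT
    rw [← intervalIntegral.integral_add_adjacent_intervals
      (hu.intervalIntegrable_generator hF hU Φ le_rfl zero_le_one)
      (hu.intervalIntegrable_generator hF hU Φ zero_le_one hT), hC₁,
      hu.cylindrical_eval_sub_eq_integral hF hU Φ one_pos hT]
  have hbound : ∀ T, 1 ≤ T → |timeMean G T| ≤ (|C₁| + 2 * M) * T⁻¹ := by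
    intro T hT
    have hT0 : 0 < T := one_pos.trans_le hT
    unfold timeMean
    rw [hsplit T hT, abs_mul, abs_inv, abs_of_pos hT0, mul_comm]
    refine mul_le_mul_of_nonneg_right ?_ (inv_nonneg.2 hT0.le)
    calc |C₁ + (Φ.eval (U T) - Φ.eval (U 1))| ≤ |C₁| + |Φ.eval (U T) - Φ.eval (U 1)| := abs_add_le _ _
      _ ≤ |C₁| + (|Φ.eval (U T)| + |Φ.eval (U 1)|) := by gcongr; exact abs_sub _ _
      _ ≤ |C₁| + (M + M) := by gcongr <;> exact hM _
      _ = |C₁| + 2 * M := by ring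
  have hlim : Tendsto (fun T : ℝ => (|C₁| + 2 * M) * T⁻¹) atTop (𝓝 0) := by
    simpa using tendsto_inv_atTop_zero.const_mul (|C₁| + 2 * M)
  refine squeeze_zero_norm' ?_ hlim
  filter_upwards [eventually_ge_atTop 1] with T hT
  rw [Real.norm_eq_abs]
  exact hbound T hT

end Trajectory

/-! ### The Liouville equation for time-average measures -/

section Liouville

variable {Λ : GeneralizedLimit} {μ : Measure (FunctionSpaces.Torus.energySpace d)}

/-- **Time-average measures satisfy the stationary Liouville equation (FMRT 2001, Ch. IV
(1.30), via Thm. 3.1 / App. B.2 (B.17)–(B.23)).** Let `μ` be a time-average measure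
(w.r.t. a generalized limit `Λ`) of the `H`-lift `U` of a global Leray–Hopf solution on `T^d`
with viscosity `ν > 0` and steady force `F ∈ L²`. Then for every cylindrical test functional `Φ`
the tested generator `u ↦ ⟨F(u), Φ'(u)⟩` is `μ`-integrable and `∫ ⟨F(u), Φ'(u)⟩ dμ(u) = 0`.
Proof: the trajectory lies in a closed ball `B ⊆ H` carrying `μ`; on `B` the continuous observable
agrees with its (bounded, continuous) product with a cutoff in `|u|²`, so
`∫ ⟨F, Φ'⟩ dμ = Lim T⁻¹ ∫₀ᵀ ⟨F(U t), Φ'(U t)⟩ dt`, and these means tend to `0`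
(`IsGlobalLerayHopf.tendsto_timeMean_generator`). [cite: FMRT2001, Ch. IV §1.2 (1.30) & App. B.2 (B.17)–(B.23)] -/
theorem IsTimeAverageMeasure.integrable_generator_and_integral_eq_zero (hν : 0 < ν)
    (hF : MemLp F 2 volume) (hu : IsGlobalLerayHopf ν (fun _ => F) u₀ u)
    (hU : ∀ t, 0 ≤ t → ((U t : L2T d) : Vec d) =ᵐ[volume] u t)
    (hμ : IsTimeAverageMeasure Λ.longTimeAvg U μ) (Φ : CylindricalTest d) :
    Integrable (fun v => nsGeneratorPairing ν F v (Φ.grad v)) μ ∧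
      ∫ v, nsGeneratorPairing ν F v (Φ.grad v) ∂μ = 0 := by
  obtain ⟨R, hR0, hR⟩ := hu.exists_forall_lift_mem_closedBall hν hF hU
  obtain ⟨K, hK0, hK⟩ := exists_abs_nsGeneratorPairing_grad_le ν hF Φ
  obtain ⟨hθc, hθ1, hθ0, hθ01⟩ := energyCutoff_props R
  set θ : ℝ → ℝ := fun x => max 0 (min 1 (R + 1 - x)) with hθ
  set Ψ : FunctionSpaces.Torus.energySpace d → ℝ := fun v => nsGeneratorPairing ν F v (Φ.grad v) with hΨ
  set Ψ' : FunctionSpaces.Torus.energySpace d → ℝ := fun v => Ψ v * θ (‖v‖ ^ 2) with hΨ'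
  have hΨ'c : Continuous Ψ' :=
    (continuous_nsGeneratorPairing_grad ν (hF.integrable one_le_two) Φ).mul
      (hθc.comp (continuous_norm.pow 2))
  have hΨ'b : ∀ v, |Ψ' v| ≤ K * (R + 2) := by
    intro v
    simp only [hΨ', hΨ]
    rw [abs_mul, abs_of_nonneg (hθ01 _).1]
    by_cases hv : ‖v‖ ^ 2 ≤ R + 1
    · calc |nsGeneratorPairing ν F v (Φ.grad v)| * θ (‖v‖ ^ 2)
          ≤ K * (1 + ‖v‖ ^ 2) * 1 :=
            mul_le_mul (hK v) (hθ01 _).2 (hθ01 _).1 (mul_nonneg hK0 (by positivity))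
        _ ≤ K * (R + 2) := by rw [mul_one]; exact mul_le_mul_of_nonneg_left (by linarith) hK0
    · rw [hθ0 _ (le_of_lt (not_le.1 hv)), mul_zero]
      positivity
  have heq : EqOn Ψ Ψ' (Metric.closedBall (0 : FunctionSpaces.Torus.energySpace d) (Real.sqrt R)) := by
    intro v hv
    have hv2 : ‖v‖ ^ 2 ≤ R := norm_sq_le_of_mem_closedBall_sqrt hR0 hv
    have hθv : θ (‖v‖ ^ 2) = 1 := hθ1 _ hv2
    show Ψ v = Ψ v * θ (‖v‖ ^ 2)
    rw [hθv, mul_one]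
  obtain ⟨hint, hId⟩ := hμ.integral_eq_of_eqOn Metric.isClosed_closedBall (fun t ht => (hR t ht).2)
    (Ψ := Ψ) hΨ'c hΨ'b heq
  refine ⟨hint, ?_⟩
  rw [hId]
  exact Λ.longTimeAvg_eq_of_tendsto (hu.tendsto_timeMean_generator hF hU Φ)

end Liouville

end Literature.Analysis.FluidPDE.Torus
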